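import Mathlib
import Literature.Computability.AlgebraicComplexity.DeterminantalConormalBoundKernelAlgebra

/-!
# Flag budgets are cancellation-free: words and powers of the top coefficient must vanish

Negative lane of the crux `GrenetZeon.DualUnipotentThreeHalves` (item `stmt-ValiantsHypothesis-24318`), line
`flag_cost` (val-idea-9 g3; tree `Cruxes/DualUnipotentThreeHalves/Lines/flag_cost.lean`, sha16 `101edfaf7b5af1ef`).
Mathlib + one Literature folklore lemma (the affine expansion `DeterminantalConormal.eq_C_add_sum_of_totalDegree_le_one`),
definition-free; it closes nothing and asserts no Theses statement (nothing here bears on `per_n`,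
the `3/2` rung or VP ≠ VNP).

The line's stub S3b `FlagCostLaw` asks that every thin affine nilpotent pencil be FLAG-CHEAP: along every line
`x + s v`, `v ∈ K`, the one-variable pencil `M(s) = M₀ + s M₁` is — after a constant change of basis `g` — ADAPTED to
levels `lvl < p` with drop `r` and weight `a+1` (`coeff_{s^d} (g M g⁻¹)_{ij} ≠ 0 ⇒ (a+1)d + lvl j ≤ lvl i + r`), with
budget `flagDeg p r a n = ⌊(p-1+r(n-1))/(a+1)⌋ ≤ k` and `(k+1)·n < dim K`.  The hypotheses below are these definitions
UNFOLDED verbatim (`FlagAdapted`, `FlagAdaptedUpTo`, `FlagCheap` of the line file), so the line applies them by `obtain`.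

What is proved (refuter's reading of S3b: a flag certifies slowness WITHOUT cancellation):
* `level_bound_word` — potential bookkeeping along an arbitrary WORD in the constant part `T₀` (drops `≤ r`) and the
  top part `T₁` (climbs `≥ a+1-r`): a nonzero entry of the word forces `(a+1)·#T₁ + lvl j ≤ lvl i + r·length`.
* `word_eq_zero_of_flagAdapted` — if `M(s)` is adapted up to conjugation with budget `≤ k`, then EVERY word of
  length `≤ n-1` in `{M₀, M₁}` (`M₀ = coeff_{s^0} M`, `M₁ = coeff_{s^1} M`) containing more than `k` letters `M₁`
  vanishes identically — not merely the symmetrised sums that make up `coeff_{s^e} M(s)^{n-1}`.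
* `top_pow_eq_zero_of_flagAdapted` — in particular `M₁^(k+1) = 0` whenever `k + 2 ≤ n`: the budget bounds the
  NIL-INDEX of the top coefficient.
* `coeff_single_aeval_line_of_totalDegree_le_one`, `top_map_aeval_line_eq_linPart` — for an AFFINE pencil the top
  coefficient along `x + s v` is the linear part `N_lin(v)`, independent of `x`; `linPart_pow_eq_zero_of_flagCheap` —
  the x-free form «`FlagCheap` ⇒ `∃ K k, (k+1)n < dim K ∧ k+2 ≤ n ∧ ∀ v ∈ K, N_lin(v)^(k+1) = 0`».
* `indexCheap_of_flagCheap` — pencil form: `FlagCheap n m N` (unfolded) ⇒ a direction space `K` with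
  `(k+1)·n < dim K`, `k+2 ≤ n`, on which every top coefficient `coeff_s (N(x+sv))` has nil-index `≤ k+1`
  («flag-cheap ⇒ index-cheap»).  For affine `N` that top coefficient is the linear part `N_lin(v)`, independent of `x`.
Use: a refutation of S3b needs no search over flags — it suffices to exhibit, inside every direction space of
dimension `> (k+1)n`, a direction whose linear part has nil-index `≥ k+2`, or a nonzero short word with `> k` top
letters; conversely S3 (`SlowPlane`) only constrains the SUM of the words with `e` top letters, so a pencil slow by
cancellation can satisfy S3 and fail S3b (evidence memo «S3b flag-cost refuter pass», item 24318). [this file; folklore]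
-/

set_option linter.dupNamespace false
set_option autoImplicit false

namespace Summit.ValiantsHypothesis.ValiantsHypothesis.Theorems.DualUnipotentThreeHalvesNegative.FlagCost

open MvPolynomial Matrix

/-- `coeff_m (p · C a) = coeff_m p · a` (right-handed twin of `MvPolynomial.coeff_C_mul`). -/
theorem coeff_mul_C_right {σ : Type*} (m : σ →₀ ℕ) (p : MvPolynomial σ ℂ) (a : ℂ) :
    coeff m (p * C a) = coeff m p * a := by
  rw [mul_comm, coeff_C_mul, mul_comm]

/-- **Potential bookkeeping along a word.**  If `T₀` lowers the level by at most `r` (`T₀ i j ≠ 0 → lvl j ≤ lvl i + r`)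
and `T₁` satisfies `T₁ i j ≠ 0 → c + lvl j ≤ lvl i + r`, then a nonzero `(i,j)` entry of a word with `e` letters `T₁`
and length `L` forces `c·e + lvl j ≤ lvl i + r·L`. -/
theorem level_bound_word {m : ℕ} (T₀ T₁ : Matrix (Fin m) (Fin m) ℂ) (lvl : Fin m → ℕ) (c r : ℕ)
    (h0 : ∀ i j, T₀ i j ≠ 0 → lvl j ≤ lvl i + r) (h1 : ∀ i j, T₁ i j ≠ 0 → c + lvl j ≤ lvl i + r) :
    ∀ (w : List Bool) (i j : Fin m), (w.map fun b => if b then T₁ else T₀).prod i j ≠ 0 →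
      c * w.count true + lvl j ≤ lvl i + r * w.length := by
  intro w
  induction w with
  | nil =>
    intro i j h
    simp only [List.map_nil, List.prod_nil] at h
    by_cases hij : i = j
    · subst hij; simp
    · exact absurd (Matrix.one_apply_ne hij) h
  | cons b w ih =>
    intro i j h
    rw [List.map_cons, List.prod_cons, Matrix.mul_apply] at h
    obtain ⟨t, -, ht⟩ := Finset.exists_ne_zero_of_sum_ne_zero h
    have hw := ih t j (right_ne_zero_of_mul ht)
    have hb := left_ne_zero_of_mul ht
    cases b with
    | true =>
      have hb' : T₁ i t ≠ 0 := by simpa using hb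
      have h2 := h1 i t hb'
      have hc : (true :: w).count true = w.count true + 1 := List.count_cons_self
      rw [hc, List.length_cons, Nat.mul_succ, Nat.mul_succ]
      generalize c * List.count true w = A at hw ⊢
      generalize r * w.length = B at hw ⊢
      omega
    | false =>
      have hb' : T₀ i t ≠ 0 := by simpa using hb
      have h2 := h0 i t hb'
      have hc : (false :: w).count true = w.count true := by simp
      rw [hc, List.length_cons, Nat.mul_succ]
      generalize c * List.count true w = A at hw ⊢
      generalize r * w.length = B at hw ⊢
      omega

/-- Coefficients commute with a constant change of basis:
`coeff_d ((g·M·g') i j) = (g · coeff_d M · g') i j` for scalar matrices `g, g'`. -/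
theorem coeff_conj_apply {m : ℕ} {σ : Type*} (G G' : Matrix (Fin m) (Fin m) ℂ)
    (M : Matrix (Fin m) (Fin m) (MvPolynomial σ ℂ)) (d : σ →₀ ℕ) (i j : Fin m) :
    coeff d ((G.map C * M * G'.map C : Matrix (Fin m) (Fin m) (MvPolynomial σ ℂ)) i j) =
      (G * M.map (coeff d) * G') i j := by
  simp only [Matrix.mul_apply, Matrix.map_apply, coeff_sum, coeff_mul_C_right, coeff_C_mul]

/-- Conjugating every letter conjugates the word (`G' G = 1`, `G G' = 1`). -/
theorem word_conj {m : ℕ} (G G' A B : Matrix (Fin m) (Fin m) ℂ) (hGG' : G * G' = 1) (hG'G : G' * G = 1) :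
    ∀ w : List Bool, (w.map fun b => if b then G * A * G' else G * B * G').prod =
      G * (w.map fun b => if b then A else B).prod * G' := by
  intro w
  induction w with
  | nil => simp [hGG']
  | cons b w ih =>
    rw [List.map_cons, List.prod_cons, List.map_cons, List.prod_cons, ih]
    cases b with
    | true =>
      simp only [ite_true]
      calc G * A * G' * (G * (List.map (fun b => if b = true then A else B) w).prod * G')
          = G * A * (G' * G) * (List.map (fun b => if b = true then A else B) w).prod * G' := by
            simp only [Matrix.mul_assoc]
        _ = G * (A * (List.map (fun b => if b = true then A else B) w).prod) * G' := by
            rw [hG'G, Matrix.mul_one]; simp only [Matrix.mul_assoc]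
    | false =>
      simp only [Bool.false_eq_true, ite_false]
      calc G * B * G' * (G * (List.map (fun b => if b = true then A else B) w).prod * G')
          = G * B * (G' * G) * (List.map (fun b => if b = true then A else B) w).prod * G' := by
            simp only [Matrix.mul_assoc]
        _ = G * (B * (List.map (fun b => if b = true then A else B) w).prod) * G' := by
            rw [hG'G, Matrix.mul_one]; simp only [Matrix.mul_assoc]

/-- **Flag-adapted ⇒ word vanishing.**  Let `M` be an `m × m` matrix of one-variable polynomials (`s = X 0`) which,
after the constant change of basis `g`, is adapted to levels `lvl < p` with drop `r` and weight `a+1`, with budget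
`(p-1+r(n-1))/(a+1) ≤ k` — i.e. `FlagAdaptedUpTo m k n M` of the line `flag_cost`, unfolded.  Then every word of length
`≤ n-1` in the constant part `M₀ = coeff_{1} ∘ M` and the top part `M₁ = coeff_{s} ∘ M` with more than `k` letters `M₁`
is ZERO. -/
theorem word_eq_zero_of_flagAdapted {m k n : ℕ} (M : Matrix (Fin m) (Fin m) (MvPolynomial (Fin 1) ℂ))
    (g : (Matrix (Fin m) (Fin m) ℂ)ˣ) (lvl : Fin m → ℕ) (p r a : ℕ) (hl : ∀ i, lvl i < p)
    (hk : (p - 1 + r * (n - 1)) / (a + 1) ≤ k)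
    (hA : ∀ (i j : Fin m) (d : Fin 1 →₀ ℕ),
      coeff d (((g : Matrix (Fin m) (Fin m) ℂ).map C * M * (↑g⁻¹ : Matrix (Fin m) (Fin m) ℂ).map C :
        Matrix (Fin m) (Fin m) (MvPolynomial (Fin 1) ℂ)) i j) ≠ 0 → (a + 1) * d 0 + lvl j ≤ lvl i + r)
    (w : List Bool) (hw : w.length ≤ n - 1) (he : k < w.count true) :
    (w.map fun b => if b then M.map (coeff (Finsupp.single 0 1)) else M.map (coeff 0)).prod = 0 := by
  set G : Matrix (Fin m) (Fin m) ℂ := (g : Matrix (Fin m) (Fin m) ℂ) with hG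
  set G' : Matrix (Fin m) (Fin m) ℂ := (↑g⁻¹ : Matrix (Fin m) (Fin m) ℂ) with hG'
  have hGG' : G * G' = 1 := by rw [hG, hG']; exact Units.mul_inv g
  have hG'G : G' * G = 1 := by rw [hG, hG']; exact Units.inv_mul g
  set M₀ := M.map (coeff (0 : Fin 1 →₀ ℕ)) with hM₀
  set M₁ := M.map (coeff (Finsupp.single (0 : Fin 1) 1)) with hM₁
  -- support conditions of the conjugated constant and top parts
  have h0 : ∀ i j, (G * M₀ * G') i j ≠ 0 → lvl j ≤ lvl i + r := by
    intro i j hij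
    rw [hM₀, ← coeff_conj_apply] at hij
    have := hA i j 0 hij
    simpa using this
  have h1 : ∀ i j, (G * M₁ * G') i j ≠ 0 → (a + 1) + lvl j ≤ lvl i + r := by
    intro i j hij
    rw [hM₁, ← coeff_conj_apply] at hij
    have := hA i j (Finsupp.single 0 1) hij
    simpa using this
  -- the budget inequality: p - 1 + r (n-1) < (k+1)(a+1)
  have hbud : p - 1 + r * (n - 1) < (k + 1) * (a + 1) :=
    (Nat.div_lt_iff_lt_mul (Nat.succ_pos a)).mp (Nat.lt_succ_of_le hk)
  -- the conjugated word vanishes by level counting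
  have hword : (w.map fun b => if b then G * M₁ * G' else G * M₀ * G').prod = 0 := by
    ext i j
    rw [Matrix.zero_apply]
    by_contra hne
    have hb := level_bound_word (G * M₀ * G') (G * M₁ * G') lvl (a + 1) r h0 h1 w i j hne
    have hi := hl i
    have hr : r * w.length ≤ r * (n - 1) := Nat.mul_le_mul_left r hw
    have hc : (a + 1) * (k + 1) ≤ (a + 1) * w.count true := Nat.mul_le_mul_left (a + 1) he
    have hcomm : (k + 1) * (a + 1) = (a + 1) * (k + 1) := Nat.mul_comm _ _
    rw [hcomm] at hbud
    generalize (a + 1) * List.count true w = A at hb hc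
    generalize r * w.length = B at hb hr
    generalize r * (n - 1) = D at hbud hr
    generalize (a + 1) * (k + 1) = E at hbud hc
    omega
  have hconj := word_conj G G' M₁ M₀ hGG' hG'G w
  rw [hconj] at hword
  -- un-conjugate
  calc (w.map fun b => if b then M₁ else M₀).prod
      = G' * (G * (w.map fun b => if b then M₁ else M₀).prod * G') * G := by
        calc (w.map fun b => if b then M₁ else M₀).prod
            = (G' * G) * (w.map fun b => if b then M₁ else M₀).prod * (G' * G) := by
              rw [hG'G, Matrix.one_mul, Matrix.mul_one]
          _ = G' * (G * (w.map fun b => if b then M₁ else M₀).prod * G') * G := by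
              simp only [Matrix.mul_assoc]
    _ = 0 := by rw [hword, Matrix.mul_zero, Matrix.zero_mul]

/-- **The budget bounds the nil-index of the top coefficient.**  Under the same (unfolded `FlagAdaptedUpTo m k n M`)
hypothesis and `k + 2 ≤ n`, the top coefficient matrix `M₁ = coeff_{s} ∘ M` satisfies `M₁^(k+1) = 0`. -/
theorem top_pow_eq_zero_of_flagAdapted {m k n : ℕ} (M : Matrix (Fin m) (Fin m) (MvPolynomial (Fin 1) ℂ))
    (g : (Matrix (Fin m) (Fin m) ℂ)ˣ) (lvl : Fin m → ℕ) (p r a : ℕ) (hl : ∀ i, lvl i < p)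
    (hk : (p - 1 + r * (n - 1)) / (a + 1) ≤ k)
    (hA : ∀ (i j : Fin m) (d : Fin 1 →₀ ℕ),
      coeff d (((g : Matrix (Fin m) (Fin m) ℂ).map C * M * (↑g⁻¹ : Matrix (Fin m) (Fin m) ℂ).map C :
        Matrix (Fin m) (Fin m) (MvPolynomial (Fin 1) ℂ)) i j) ≠ 0 → (a + 1) * d 0 + lvl j ≤ lvl i + r)
    (hkn : k + 2 ≤ n) :
    (M.map (coeff (Finsupp.single (0 : Fin 1) 1))) ^ (k + 1) = 0 := by
  have h := word_eq_zero_of_flagAdapted M g lvl p r a hl hk hA (List.replicate (k + 1) true)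
    (by rw [List.length_replicate]; omega) (by rw [List.count_replicate_self]; omega)
  simpa [List.map_replicate, List.prod_replicate] using h

/-- **Flag-cheap ⇒ index-cheap** (pencil form).  The hypothesis is `FlagCheap n m N` of the line `flag_cost`,
unfolded (`lineSubst x v = aeval (c ↦ C (x c) + Σ_{t : Fin 1} C (v c)·X t)`): a direction space `K` and a budget `k`
with `(k+1)·n < dim K` such that along every line `x + s v`, `v ∈ K`, the substituted pencil is adapted, up to a constant
change of basis, to a flag of budget `≤ k`.  Conclusion: on that SAME `K`, `k + 2 ≤ n` and every top coefficient
`coeff_s N(x + s v)` is nilpotent of index `≤ k + 1`.  (For affine `N` the top coefficient is the linear part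
`N_lin(v)`, independent of `x`.) -/
theorem indexCheap_of_flagCheap {n m : ℕ} (N : Matrix (Fin m) (Fin m) (MvPolynomial (Fin n × Fin n) ℂ))
    (h : ∃ (K : Submodule ℂ (Fin n × Fin n → ℂ)) (k : ℕ),
      (∀ x v : Fin n × Fin n → ℂ, v ∈ K →
        ∃ (g : (Matrix (Fin m) (Fin m) ℂ)ˣ) (lvl : Fin m → ℕ) (p r a : ℕ),
          (∀ i, lvl i < p) ∧ (p - 1 + r * (n - 1)) / (a + 1) ≤ k ∧
          ∀ (i j : Fin m) (d : Fin 1 →₀ ℕ),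
            coeff d (((g : Matrix (Fin m) (Fin m) ℂ).map C *
              N.map (aeval fun c => (C (x c) + ∑ t : Fin 1, C (v c) * X t : MvPolynomial (Fin 1) ℂ)) *
              (↑g⁻¹ : Matrix (Fin m) (Fin m) ℂ).map C : Matrix (Fin m) (Fin m) (MvPolynomial (Fin 1) ℂ)) i j) ≠ 0 →
              (a + 1) * d 0 + lvl j ≤ lvl i + r) ∧
      (k + 1) * n < Module.finrank ℂ K) :
    ∃ (K : Submodule ℂ (Fin n × Fin n → ℂ)) (k : ℕ), (k + 1) * n < Module.finrank ℂ K ∧ k + 2 ≤ n ∧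
      ∀ x v : Fin n × Fin n → ℂ, v ∈ K →
        ((N.map (aeval fun c => (C (x c) + ∑ t : Fin 1, C (v c) * X t : MvPolynomial (Fin 1) ℂ))).map
          (coeff (Finsupp.single (0 : Fin 1) 1))) ^ (k + 1) = 0 := by
  obtain ⟨K, k, hadapt, hdim⟩ := h
  have hK : Module.finrank ℂ K ≤ n * n := by
    have h1 := Submodule.finrank_le K
    rw [Module.finrank_fintype_fun_eq_card, Fintype.card_prod, Fintype.card_fin] at h1
    exact h1
  have hkn : k + 2 ≤ n := by
    have h2 : (k + 1) * n < n * n := lt_of_lt_of_le hdim hK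
    have h3 : k + 1 < n := Nat.lt_of_mul_lt_mul_right h2
    omega
  refine ⟨K, k, hdim, hkn, ?_⟩
  intro x v hv
  obtain ⟨g, lvl, p, r, a, hl, hk, hA⟩ := hadapt x v hv
  exact top_pow_eq_zero_of_flagAdapted _ g lvl p r a hl hk hA hkn

/-- Along the line `x + s v`, the top (`s¹`) coefficient of an AFFINE polynomial `q` is its linear part paired with
the direction: `coeff_s q(x + s v) = Σ_c v_c · coeff_{X_c} q` — independent of the base point `x`. -/
theorem coeff_single_aeval_line_of_totalDegree_le_one {σ : Type*} [Fintype σ] (q : MvPolynomial σ ℂ)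
    (hq : q.totalDegree ≤ 1) (x v : σ → ℂ) :
    coeff (Finsupp.single (0 : Fin 1) 1)
      (aeval (fun c => (C (x c) + ∑ t : Fin 1, C (v c) * X t : MvPolynomial (Fin 1) ℂ)) q) =
      ∑ c, v c * coeff (Finsupp.single c 1) q := by
  classical
  have h10 : ¬ ((0 : Fin 1 →₀ ℕ) = Finsupp.single 0 1) := Ne.symm (Finsupp.single_ne_zero.mpr one_ne_zero)
  conv_lhs =>
    rw [Literature.Computability.AlgebraicComplexity.DeterminantalConormal.eq_C_add_sum_of_totalDegree_le_one hq]
  simp only [map_add, map_sum, map_mul, aeval_C, aeval_X, algebraMap_eq, Fin.sum_univ_zero, Fin.sum_univ_succ,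
    add_zero, coeff_add, coeff_sum, coeff_C_mul, coeff_C, if_neg h10, mul_add, mul_zero, zero_add, coeff_X_same,
    mul_one]
  exact Finset.sum_congr rfl fun c _ => mul_comm _ _

/-- Matrix form: for an entrywise AFFINE pencil `N` (`IsAffine N` of the tree, unfolded), the top coefficient of
`N(x + s v)` is the LINEAR PART `N_lin(v) = (Σ_c v_c · coeff_{X_c} N_{ij})_{ij}` (the `linCoeff N v` of the line
`thin_wild`), whatever the base point `x`. -/
theorem top_map_aeval_line_eq_linPart {n m : ℕ} (N : Matrix (Fin m) (Fin m) (MvPolynomial (Fin n × Fin n) ℂ))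
    (hN : ∀ i j, (N i j).totalDegree ≤ 1) (x v : Fin n × Fin n → ℂ) :
    (N.map (aeval fun c => (C (x c) + ∑ t : Fin 1, C (v c) * X t : MvPolynomial (Fin 1) ℂ))).map
        (coeff (Finsupp.single (0 : Fin 1) 1)) =
      Matrix.of fun i j => ∑ c, v c * coeff (Finsupp.single c 1) (N i j) := by
  ext i j
  simp only [Matrix.map_apply, Matrix.of_apply]
  exact coeff_single_aeval_line_of_totalDegree_le_one _ (hN i j) x v

/-- **Flag-cheap ⇒ index-cheap, affine pencils** (the form a refuter attacks).  If the entrywise affine pencil `N`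
is `FlagCheap` (line `flag_cost`, unfolded), then there are a direction space `K` and `k` with `(k+1)·n < dim K`,
`k + 2 ≤ n`, such that the LINEAR PART `N_lin(v)` is nilpotent of index `≤ k+1` for every `v ∈ K`.
Contrapositive (certificate for `¬ FlagCheap n m N`): for every `k ≤ n-2`, every subspace `K ⊆ ℂ^{n×n}` with
`dim K > (k+1)·n` contains a direction `v` with `N_lin(v)^{k+1} ≠ 0`. -/
theorem linPart_pow_eq_zero_of_flagCheap {n m : ℕ} (N : Matrix (Fin m) (Fin m) (MvPolynomial (Fin n × Fin n) ℂ))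
    (hN : ∀ i j, (N i j).totalDegree ≤ 1)
    (h : ∃ (K : Submodule ℂ (Fin n × Fin n → ℂ)) (k : ℕ),
      (∀ x v : Fin n × Fin n → ℂ, v ∈ K →
        ∃ (g : (Matrix (Fin m) (Fin m) ℂ)ˣ) (lvl : Fin m → ℕ) (p r a : ℕ),
          (∀ i, lvl i < p) ∧ (p - 1 + r * (n - 1)) / (a + 1) ≤ k ∧
          ∀ (i j : Fin m) (d : Fin 1 →₀ ℕ),
            coeff d (((g : Matrix (Fin m) (Fin m) ℂ).map C *
              N.map (aeval fun c => (C (x c) + ∑ t : Fin 1, C (v c) * X t : MvPolynomial (Fin 1) ℂ)) *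
              (↑g⁻¹ : Matrix (Fin m) (Fin m) ℂ).map C : Matrix (Fin m) (Fin m) (MvPolynomial (Fin 1) ℂ)) i j) ≠ 0 →
              (a + 1) * d 0 + lvl j ≤ lvl i + r) ∧
      (k + 1) * n < Module.finrank ℂ K) :
    ∃ (K : Submodule ℂ (Fin n × Fin n → ℂ)) (k : ℕ), (k + 1) * n < Module.finrank ℂ K ∧ k + 2 ≤ n ∧
      ∀ v : Fin n × Fin n → ℂ, v ∈ K →
        (Matrix.of fun i j => ∑ c, v c * coeff (Finsupp.single c 1) (N i j)) ^ (k + 1) = 0 := by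
  obtain ⟨K, k, hdim, hkn, htop⟩ := indexCheap_of_flagCheap N h
  refine ⟨K, k, hdim, hkn, fun v hv => ?_⟩
  rw [← top_map_aeval_line_eq_linPart N hN 0 v]
  exact htop 0 v hv

end Summit.ValiantsHypothesis.ValiantsHypothesis.Theorems.DualUnipotentThreeHalvesNegative.FlagCost
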